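import Literature.AnabelianGeometry.AbsoluteAnabelian.ArchimedeanReconstruction

/-!
# Kernel witness W-F10-6: the `∃!` of `NFCurveData.ReconstructsAutHol` fails at a toy datum

Finding F10-6 (referee lane f, [AbsTopIII] Cor 2.8 (b), kurims p. 64 "the unique … Aut-holomorphic
structure that extends the pre-Aut-holomorphic structure determined by the groups `𝒜_X(U_X)`"):
the named schema `NFCurveData.ReconstructsAutHol` (`ArchimedeanReconstruction.lean`, abc-iut-L4
lineage) quantifies `∃!` over ARBITRARY assignments `U ↦ A(U) ≤ Aut(U^top)` on connected opens
(`AutHolStructure` carries no axiom), so on a connected open that admits no chart into `k_v` the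
reconstruction predicate `IsReconstructedStructure` constrains nothing and uniqueness fails.
This file is the KERNEL WITNESS wanted by abc-iut-L4-lead (RULINGS #3 (3)(ii), 2026-08-26):

* `exists_not_reconstructsAutHol : ∃ D : NFCurveData, ¬ D.ReconstructsAutHol`.

The witness datum `D₂` (WITNESS DATA, not a model of any curve): two NF-points `Bool`, one
NF-rational function with a pole at BOTH points (`eval ≡ none`), `k_NF = ℚ ↪ k_v = ℝ`, trivial
extension.  Then the constant sequences at the two points are Cauchy (conductor = the other
point), they are NOT equivalent (no common conductor), every set `N(U,f)` is empty (no sequence has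
eventually finite values), so `X^top` is a TWO-POINT INDISCRETE space; its only nonempty open is
the whole space, which is connected, admits the swap as a non-identity self-homeomorphism, and
admits NO chart (a chart is a homeomorphism onto an open of `ℝ`, which separates points).  Hence
every `AutHolStructure` is reconstructed and `⊥ ≠ ⊤` are two of them.  Pattern of the toy data after
abc-iut-w5-d140's audit kit `Cor28TopologyWitness` (trivial `ext`, `k_v = ℝ`).

Consequence of record (dag, L4-lead RULINGS #2 (2) / #3 (3)): `ReconstructsAutHol` is NOT-THE-FACT
(universal closure refuted); consumers cite the charted reading `NFCurveData.ReconstructsAutHolOnCharts`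
(`ArchimedeanReconstructionCor28Sub.lean`).  HONEST FRAMING: a statement about OUR typed interface,
not about print's Corollary 2.8; no bearing on [IUTchIII] Cor 3.12.
-/

noncomputable section

namespace Literature.AnabelianGeometry.AbsoluteAnabelian.ArchimedeanReconstruction.AutHolWitness

open _root_.Filter _root_.Topology _root_.Set _root_.TopologicalSpace

/-- WITNESS DATA: a one-element profinite group (for the unused `ext` slot).
[cite: MochizukiAbsTopIII2015, Corollary 2.8 p.63] -/
abbrev P₀ : ProfiniteGrp.{0} := ProfiniteGrp.ofFiniteGrp (FiniteGrp.of PUnit.{1})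

/-- WITNESS DATA: the trivial extension `1 → 1 → 1 → 1 → 1`. [cite: MochizukiAbsTopIII2015, Corollary 2.8 p.63] -/
abbrev ext₀ : FundamentalExtension.{0} where
  arith := P₀
  gal := P₀
  aug := ContinuousMonoidHom.id _
  aug_surjective := Function.surjective_id

/-- **WITNESS DATA `D₂`**: two NF-points, one NF-rational function with a pole at both points,
`k_NF = ℚ ↪ k_v = ℝ`.  Not a model of a curve; built to exhibit the failure of the `∃!`.
[cite: MochizukiAbsTopIII2015, Corollary 2.8 p.63] -/
abbrev D₂ : NFCurveData where
  ext := ext₀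
  Pt := Bool
  decomp _ := ⊥
  Fn := Unit
  kNF := ℚ
  eval _ _ := none
  kv := ℝ
  emb := Rat.castHom ℝ
  denseRange_emb := Rat.denseRange_cast
  one_lt_norm_two := by norm_num

/-! ### Cauchy sequences of `D₂`: eventually constant, two inequivalent classes -/

/-- A conductor for which a sequence is Cauchy is nonempty (the empty conductor would force the
values of the everywhere-polar function to be eventually finite). [cite: MochizukiAbsTopIII2015, Corollary 2.8 (a) p.63] -/
theorem conductor_nonempty {x : ℕ → Bool} {S : Finset Bool} (h : D₂.IsCauchyWith x S) :
    S.Nonempty := by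
  rw [Finset.nonempty_iff_ne_empty]
  rintro rfl
  have hf : D₂.PolesAvoid () (∅ : Finset Bool) := fun x hx => by simp at hx
  obtain ⟨j, hj⟩ := (h.eventually_finite () hf).exists
  exact hj rfl

/-- With a nonempty conductor no function has its poles off the conductor. [cite: MochizukiAbsTopIII2015, Corollary 2.8 (a) p.63] -/
theorem not_polesAvoid {S : Finset Bool} (hS : S.Nonempty) (f : D₂.Fn) : ¬ D₂.PolesAvoid f S := by
  obtain ⟨b, hb⟩ := hS
  intro h
  exact h b hb rfl

/-- A sequence avoiding `b` eventually is Cauchy with conductor `{b}`. [cite: MochizukiAbsTopIII2015, Corollary 2.8 (a) p.63] -/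
theorem isCauchyWith_singleton {x : ℕ → Bool} {b : Bool} (h : ∀ᶠ j in atTop, x j ≠ b) :
    D₂.IsCauchyWith x {b} where
  eventually_not_mem := h.mono fun j hj => by simpa using hj
  eventually_finite f hf := (not_polesAvoid (Finset.singleton_nonempty b) f hf).elim
  cauchy f hf := (not_polesAvoid (Finset.singleton_nonempty b) f hf).elim

/-- Every Cauchy sequence of `D₂` eventually avoids some point `b` (i.e. is eventually `!b`). [cite: MochizukiAbsTopIII2015, Corollary 2.8 (a) p.63] -/
theorem exists_eventually_ne {x : ℕ → Bool} (hx : D₂.IsCauchy x) : ∃ b : Bool, ∀ᶠ j in atTop, x j ≠ b := by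
  obtain ⟨S, hS⟩ := hx
  obtain ⟨b, hb⟩ := conductor_nonempty hS
  exact ⟨b, hS.eventually_not_mem.mono fun j hj h => hj (h ▸ hb)⟩

/-- The invariant separating the two classes: "eventually `true`". [cite: MochizukiAbsTopIII2015, Corollary 2.8 (a) p.63] -/
def EvTrue (x : ℕ → Bool) : Prop := ∀ᶠ j in atTop, x j = true

/-- A sequence eventually avoiding `b` is eventually `true` iff `b = false`. [cite: MochizukiAbsTopIII2015, Corollary 2.8 (a) p.63] -/
theorem evTrue_iff_of_eventually_ne {x : ℕ → Bool} {b : Bool} (h : ∀ᶠ j in atTop, x j ≠ b) :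
    EvTrue x ↔ b = false := by
  constructor
  · intro ht
    obtain ⟨j, hj⟩ := (ht.and h).exists
    cases b
    · rfl
    · exact (hj.2 hj.1).elim
  · rintro rfl
    exact h.mono fun j hj => by simpa using hj

/-- `CauchyEquiv` preserves the invariant: two sequences with a COMMON conductor are eventually
equal to the same constant. [cite: MochizukiAbsTopIII2015, Corollary 2.8 (a) p.63] -/
theorem evTrue_iff_of_cauchyEquiv {x y : ℕ → Bool} (h : D₂.CauchyEquiv x y) : EvTrue x ↔ EvTrue y := by
  obtain ⟨S, hx, hy, -⟩ := h
  obtain ⟨b, hb⟩ := conductor_nonempty hx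
  have hx' : ∀ᶠ j in atTop, x j ≠ b := hx.eventually_not_mem.mono fun j hj h => hj (h ▸ hb)
  have hy' : ∀ᶠ j in atTop, y j ≠ b := hy.eventually_not_mem.mono fun j hj h => hj (h ▸ hb)
  rw [evTrue_iff_of_eventually_ne hx', evTrue_iff_of_eventually_ne hy']

/-- The invariant is constant along the equivalence relation generated by `CauchyEquiv`. [cite: MochizukiAbsTopIII2015, Corollary 2.8 (a) p.63] -/
theorem evTrue_iff_of_eqvGen {x y : {x : ℕ → Bool // D₂.IsCauchy x}}
    (h : Relation.EqvGen (fun x y : {x : ℕ → Bool // D₂.IsCauchy x} => D₂.CauchyEquiv x.1 y.1) x y) :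
    EvTrue x.1 ↔ EvTrue y.1 := by
  induction h with
  | rel a b hab => exact evTrue_iff_of_cauchyEquiv hab
  | refl a => exact Iff.rfl
  | symm a b _ ih => exact ih.symm
  | trans a b c _ _ ih₁ ih₂ => exact ih₁.trans ih₂

/-- Equal classes in `X^top` have the same invariant. [cite: MochizukiAbsTopIII2015, Corollary 2.8 (a) p.63] -/
theorem evTrue_iff_of_mk_eq {x y : {x : ℕ → Bool // D₂.IsCauchy x}}
    (h : (Quot.mk _ x : D₂.Xtop) = Quot.mk _ y) : EvTrue x.1 ↔ EvTrue y.1 :=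
  evTrue_iff_of_eqvGen (Quot.eqvGen_exact h)

/-- The constant sequence at `c`, Cauchy with conductor `{!c}`. [cite: MochizukiAbsTopIII2015, Corollary 2.8 (a) p.63] -/
def const (c : Bool) : {x : ℕ → Bool // D₂.IsCauchy x} :=
  ⟨fun _ => c, ⟨{!c}, isCauchyWith_singleton (Eventually.of_forall fun _ => by cases c <;> simp)⟩⟩

/-- Values of the constant sequence. [cite: MochizukiAbsTopIII2015, Corollary 2.8 (a) p.63] -/
@[simp] theorem const_apply (c : Bool) (j : ℕ) : (const c).1 j = c := rfl

/-- The two points `P = [true]`, `Q = [false]` of `X^top`. [cite: MochizukiAbsTopIII2015, Corollary 2.8 (a) p.63] -/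
def pt (c : Bool) : D₂.Xtop := Quot.mk _ (const c)

/-- **The two points of `X^top` are distinct** (no common conductor: the invariant separates them). [cite: MochizukiAbsTopIII2015, Corollary 2.8 (a) p.63] -/
theorem pt_true_ne_pt_false : pt true ≠ pt false := by
  intro h
  have h' := evTrue_iff_of_mk_eq h
  have ht : EvTrue (const true).1 := Eventually.of_forall fun _ => rfl
  obtain ⟨j, hj⟩ := (h'.1 ht).exists
  exact Bool.false_ne_true hj

/-- `X^top` has exactly the two points `pt true`, `pt false`. [cite: MochizukiAbsTopIII2015, Corollary 2.8 (a) p.63] -/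
theorem eq_pt (z : D₂.Xtop) : ∃ c : Bool, z = pt c := by
  induction z using Quot.ind with
  | mk x =>
    obtain ⟨b, hb⟩ := exists_eventually_ne x.2
    refine ⟨!b, Quot.sound ⟨{b}, isCauchyWith_singleton hb,
      isCauchyWith_singleton (Eventually.of_forall fun _ => by cases b <;> simp), fun f hf => ?_⟩⟩
    exact (not_polesAvoid (Finset.singleton_nonempty b) f hf).elim

/-! ### The topology of `X^top` is indiscrete -/

/-- Every basic set `N(U,f)` of the witness is EMPTY: no sequence has eventually finite values of the
everywhere-polar function. [cite: MochizukiAbsTopIII2015, Corollary 2.8 (a) p.63] -/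
theorem N_eq_empty (U : Set ℝ) (f : D₂.Fn) : D₂.N U f = ∅ := by
  ext x
  simp only [NFCurveData.N, mem_setOf_eq, mem_empty_iff_false, iff_false, not_and]
  intro h
  obtain ⟨j, hj⟩ := h.exists
  exact (hj rfl).elim

/-- Every open subset of `X^top` is `∅` or `univ`. [cite: MochizukiAbsTopIII2015, Corollary 2.8 (a) p.63] -/
theorem isOpen_iff_empty_or_univ (O : Set D₂.Xtop) (hO : IsOpen O) : O = ∅ ∨ O = univ := by
  change GenerateOpen _ O at hO
  induction hO with
  | basic s hs =>
    obtain ⟨U, f, -, rfl⟩ := hs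
    exact Or.inl (by rw [N_eq_empty]; exact image_empty _)
  | univ => exact Or.inr rfl
  | inter s t _ _ ihs iht =>
    rcases ihs with rfl | rfl
    · exact Or.inl (empty_inter t)
    · rcases iht with rfl | rfl
      · exact Or.inl (inter_empty _)
      · exact Or.inr (inter_univ _)
  | sUnion K _ ih =>
    by_cases hK : univ ∈ K
    · exact Or.inr (eq_univ_of_univ_subset (subset_sUnion_of_mem hK))
    · left
      refine sUnion_eq_empty.2 fun s hs => ?_
      rcases ih s hs with h | h
      · exact h
      · exact (hK (h ▸ hs)).elim

/-- `X^top` is indiscrete: any two points are topologically inseparable. [cite: MochizukiAbsTopIII2015, Corollary 2.8 (a) p.63] -/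
theorem inseparable (z w : D₂.Xtop) : Inseparable z w :=
  inseparable_iff_forall_isOpen.2 fun s hs => by
    rcases isOpen_iff_empty_or_univ s hs with rfl | rfl <;> simp

/-- Every map into the indiscrete `X^top` is continuous. [cite: MochizukiAbsTopIII2015, Corollary 2.8 (a) p.63] -/
theorem continuous_of_indiscrete {Y : Type} [TopologicalSpace Y] (g : Y → D₂.Xtop) : Continuous g :=
  continuous_def.2 fun s hs => by
    rcases isOpen_iff_empty_or_univ s hs with rfl | rfl
    · simp
    · simp

/-- The whole (indiscrete, nonempty) space `X^top` is connected. [cite: MochizukiAbsTopIII2015, Corollary 2.8 (a) p.63] -/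
theorem isConnected_univ : IsConnected (univ : Set D₂.Xtop) := by
  refine ⟨⟨pt true, mem_univ _⟩, ?_⟩
  intro u v hu hv _ hu' hv'
  obtain ⟨a, -, ha⟩ := hu'
  obtain ⟨b, -, hb⟩ := hv'
  rcases isOpen_iff_empty_or_univ u hu with rfl | rfl
  · exact ha.elim
  rcases isOpen_iff_empty_or_univ v hv with rfl | rfl
  · exact hb.elim
  exact ⟨pt true, by simp⟩

/-- The whole space as a connected open of `X^top`. [cite: MochizukiAbsTopIII2015, Corollary 2.8 (b) p.64] -/
def Utop : ConnectedOpens D₂.Xtop := ⟨⊤, by simpa using isConnected_univ⟩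

/-! ### No charts; two reconstructed structures -/

/-- **No connected open of `X^top` admits a chart**: a chart is a homeomorphism onto an open subset of
`ℝ`; it would carry the two inseparable points of `X^top` (both lie in every nonempty open) to two
distinct inseparable points of a `T₀` space. [cite: MochizukiAbsTopIII2015, Corollary 2.8 (b) p.64] -/
theorem chart_false (UX : ConnectedOpens D₂.Xtop) (c : D₂.Chart UX.1) : False := by
  have hU : ((UX.1 : Opens D₂.Xtop) : Set D₂.Xtop) = univ := by
    rcases isOpen_iff_empty_or_univ _ UX.1.isOpen with h | h
    · exact (UX.2.nonempty.ne_empty h).elim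
    · exact h
  have hP : pt true ∈ (UX.1 : Set D₂.Xtop) := by rw [hU]; exact mem_univ _
  have hQ : pt false ∈ (UX.1 : Set D₂.Xtop) := by rw [hU]; exact mem_univ _
  have hins : Inseparable (⟨pt true, hP⟩ : UX.1) ⟨pt false, hQ⟩ :=
    Topology.IsInducing.subtypeVal.inseparable_iff.1 (inseparable _ _)
  have himg : Inseparable (c.fU ⟨pt true, hP⟩) (c.fU ⟨pt false, hQ⟩) := hins.map c.fU.continuous
  have heq := c.fU.injective himg.eq
  exact pt_true_ne_pt_false (congrArg Subtype.val heq)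

/-- Every assignment of groups is a reconstructed structure for `D₂` (there are no charts). [cite: MochizukiAbsTopIII2015, Corollary 2.8 (b) p.64] -/
theorem isReconstructedStructure (A : AutHolStructure D₂.Xtop) : D₂.IsReconstructedStructure A :=
  fun UX c _ => (chart_false UX c).elim

open Classical in
/-- The swap `P ↔ Q` of `X^top` as a self-homeomorphism of the (indiscrete) open `⊤`. [cite: MochizukiAbsTopIII2015, Corollary 2.8 (b) p.64] -/
def swapTop : (Utop.1 : Opens D₂.Xtop) ≃ₜ (Utop.1 : Opens D₂.Xtop) where
  toFun p := ⟨if p.1 = pt true then pt false else pt true, trivial⟩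
  invFun p := ⟨if p.1 = pt true then pt false else pt true, trivial⟩
  left_inv p := by
    apply Subtype.ext
    obtain ⟨c, hc⟩ := eq_pt p.1
    cases c
    · simp [hc, pt_true_ne_pt_false.symm]
    · simp [hc, pt_true_ne_pt_false.symm]
  right_inv p := by
    apply Subtype.ext
    obtain ⟨c, hc⟩ := eq_pt p.1
    cases c
    · simp [hc, pt_true_ne_pt_false.symm]
    · simp [hc, pt_true_ne_pt_false.symm]
  continuous_toFun := continuous_induced_rng.2 (continuous_of_indiscrete _)
  continuous_invFun := continuous_induced_rng.2 (continuous_of_indiscrete _)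

/-- The swap is not the identity (it moves `P = [true]` to `Q = [false] ≠ P`). [cite: MochizukiAbsTopIII2015, Corollary 2.8 (b) p.64] -/
theorem swapTop_ne_one : swapTop ≠ 1 := by
  intro h
  have h1 : (swapTop ⟨pt true, trivial⟩ : (Utop.1 : Opens D₂.Xtop)).1 = pt true := by
    rw [h]; rfl
  have h2 : (swapTop ⟨pt true, trivial⟩ : (Utop.1 : Opens D₂.Xtop)).1 = pt false := by
    simp [swapTop]
  exact pt_true_ne_pt_false (h1.symm.trans h2)

/-- **W-F10-6 (kernel witness for finding F10-6).**  The `∃!` of the named schema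
`NFCurveData.ReconstructsAutHol` fails at the witness datum `D₂`: `X^top` is a two-point indiscrete
space, no connected open admits a chart into `k_v = ℝ`, so every `AutHolStructure` is reconstructed,
and `U ↦ ⊥`, `U ↦ ⊤` are two distinct ones (the swap is a non-identity self-homeomorphism of the
connected open `⊤`).  Universal closure of the schema REFUTED; instance-level readings
(`ReconstructsAutHolOnCharts`) unaffected. [cite: MochizukiAbsTopIII2015, Corollary 2.8 (b) p.64] -/
theorem exists_not_reconstructsAutHol : ∃ D : NFCurveData, ¬ D.ReconstructsAutHol := by
  refine ⟨D₂, fun h => ?_⟩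
  have heq : (⟨fun _ => ⊥⟩ : AutHolStructure D₂.Xtop) = ⟨fun _ => ⊤⟩ :=
    h.unique (isReconstructedStructure _) (isReconstructedStructure _)
  have hbt : (⊥ : Subgroup ((Utop.1 : Opens D₂.Xtop) ≃ₜ (Utop.1 : Opens D₂.Xtop))) = ⊤ :=
    congrFun (congrArg AutHolStructure.aut heq) Utop
  have hmem : swapTop ∈ (⊥ : Subgroup ((Utop.1 : Opens D₂.Xtop) ≃ₜ (Utop.1 : Opens D₂.Xtop))) := by
    rw [hbt]; exact Subgroup.mem_top _
  exact swapTop_ne_one (Subgroup.mem_bot.1 hmem)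

end Literature.AnabelianGeometry.AbsoluteAnabelian.ArchimedeanReconstruction.AutHolWitness

end
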